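import Literature.NumberTheory.Sieve.HeathBrownMorozClassTypeIHead
import Literature.NumberTheory.Sieve.HeathBrownMorozClassSingularSeries
import Literature.NumberTheory.Sieve.HeathBrownMorozClassLemma51
import Literature.NumberTheory.Sieve.HeathBrownCubicTypeIHolds
import HarnessLib

/-!
# The class Type-I estimate (Heath-Brown–Moroz 2004, Lemma 2.3, in Heath-Brown's ideal frame)

Pure-proof file completing the residue-class ("coset") port of D. R. Heath-Brown, *Primes
represented by `x³ + 2y³`*, Acta Math. 186 (2001), **Lemma 3.2** (§5, pp. 30–32), to the class
`x ≡ a, y ≡ b (mod d)` of D. R. Heath-Brown and B. Z. Moroz, *On the representation of primes by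
cubic polynomials in two variables*, Proc. LMS 88 (2004), §2 (Lemma 2.3 with Lemma 2.4): for every
`A ≥ 1` there are absolute `c, C ≥ 0` such that for every modulus `d ≥ 1`, every admissible class
`(a, b)` (`(a³ + 2b³, d) = 1`), `X ≥ 4(d+2)²`, `0 < η ≤ 1` and `Q ≥ 1`,
`∑_{Q<N(R)≤2Q, R∈𝒯r} τ(R)^A |#𝒜_R(class) − [(d,N(R))=1]·(6η²X²/π²)(ζ(2)/ζ_d(2))d⁻²ρ₂(R)/N(R)|
   ≤ C (Q + XQ^{1/2} + X^{3/2}) (log QX)^c`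
(`class_typeI_A`).  Here `#𝒜_R(class) = CubicSieve.classCountA X η d a b R` counts the pairs of the
class in `(X, X(1+η)]²` with coprime coordinates and `R ∣ (x + y·2^{1/3})`, and the main term is the
one of [HBM, (2.29)] — `η²X²Γ(q)/ζ_d(2)` — in the ideal frame: `ζ(2)/ζ_d(2) = zetaTwoCorrection d`,
the factor `d⁻²` is the density of the class, `(6/π²)ρ₂(R)/N(R)` is Heath-Brown's main term, and the
vanishing of `Γ` at `p ∣ d` is the indicator `[(d, N(R)) = 1]`.

The proof is the 2001 argument word for word (`HeathBrown2001_typeI_A_of_bounds` of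
`HeathBrownCubicTypeIProofs`) on the class bricks of the port: the split at `Δ`
(`abs_classCountA_sub_mainTerm_le`, class (5.3)/(5.4), file `HeathBrownMorozClassSingularSeries`),
the head `g ≤ Δ` via the class Lemma 5.1 (`class_lemma_5_1_bound_of_lemma_4_7_bound`, uniform in
the class; `class_head_total_le`), the tail (5.6) via Lemma 4.7 (the class count is at most the
full count, so `tail56_total_le` applies verbatim), the tail (5.5) (`exists_tail55_le`, after
`d⁻² ≤ 1`), the moments of `τ` and `Δ = 1 + min(X^{1/2}, XQ^{-1/2})` (`delta_bounds`).  Both deep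
inputs are theorems of the tree (`lemma_4_7_bound_holds`), so the result is unconditional.

## Faithfulness / deviations
* The range `X ≥ 4(d+2)²` (instead of `X ≥ 2`) makes `gd ≤ X`, `2g ≤ X` for all `g ≤ Δ ≤ 1 + X^{1/2}`,
  the range of the class Lemma 5.1 as proved; for fixed `d` and `X → ∞` (the only use, [HBM, §3])
  this is harmless.  Constants are absolute — uniform in `d` and the class — which the source does
  not claim ("depending on `f`") but the port yields.
* `η` is only required to satisfy `0 < η ≤ 1` (the source's range (2.1) is narrower).
[cite: HeathBrownMoroz2004, Lemma 2.3] [cite: HeathBrownActa2001, Lemma 3.2, §5 pp. 30–32]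

## Search
`lean search 'typeI_residueClass|class_typeI|classCountA'`: the named fact
`CubicPrimes.HeathBrownMoroz2004_typeI_residueClass` (rational moduli `q`, printed frame, unproved)
and the class bricks of this port; no class Type-I theorem over ideals before this file.
-/

noncomputable section

open NumberField Finset Filter

open scoped Topology ArithmeticFunction.sigma

namespace Literature.NumberTheory.Sieve.CubicSieve

open LFunctions.CubeRootTwoField CubicPrimes

open scoped Classical in
/-- The class count in the Möbius sum is at most the full count:
`#{box(X/g) : gx ≡ a, gy ≡ b (d), R ∣ (g)I} ≤ #{box(X/g) : R ∣ (g)I}`. [cite: HeathBrownMoroz2004, Lemma 2.3] -/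
theorem class_moebiusTerm_le (Y η : ℝ) (g d a b : ℕ) (R : Ideal (𝓞 K)) :
    #{xy ∈ latticeBox Y η | g * xy.1 ≡ a [MOD d] ∧ g * xy.2 ≡ b [MOD d] ∧
        R ∣ Ideal.span {(g : 𝓞 K)} * pairIdeal xy} ≤
      #{xy ∈ latticeBox Y η | R ∣ Ideal.span {(g : 𝓞 K)} * pairIdeal xy} :=
  card_le_card fun xy hxy => by
    rw [mem_filter] at hxy ⊢
    exact ⟨hxy.1, hxy.2.2.2⟩

set_option maxHeartbeats 1000000 in
open scoped Classical in
/-- **Heath-Brown–Moroz 2004, Lemma 2.3 (with Lemma 2.4), in Heath-Brown's ideal frame — the class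
Type-I estimate.**  For every `A ≥ 1` there are `c, C ≥ 0` such that for all `d ≥ 1`, all
admissible classes `(a, b) mod d` (`a, b < d`, `(a³ + 2b³, d) = 1`), all `X ≥ 4(d+2)²`,
`0 < η ≤ 1`, `Q ≥ 1`:
`∑_{Q<N(R)≤2Q, R∈𝒯r} τ(R)^A |#𝒜_R(class) − [(d,N(R))=1]·(6η²X²/π²)(ζ(2)/ζ_d(2))d⁻²ρ₂(R)/N(R)|
   ≤ C (Q + XQ^{1/2} + X^{3/2}) (log QX)^c`.
Proof: the 2001 proof of Lemma 3.2 (pp. 30–32) on the class bricks — split at `Δ`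
(`abs_classCountA_sub_mainTerm_le`), head via the class Lemma 5.1 (`class_head_total_le`), tails
(5.6) (`tail56_total_le`, the class count being at most the full one) and (5.5)
(`exists_tail55_le`), with `Δ = 1 + min(X^{1/2}, XQ^{-1/2})`; Lemmas 4.7 and 5.1 are the tree's
theorems `lemma_4_7_bound_holds`, `class_lemma_5_1_bound_of_lemma_4_7_bound`.
[cite: HeathBrownMoroz2004, Lemma 2.3] [cite: HeathBrownActa2001, Lemma 3.2] -/
theorem class_typeI_A (A : ℕ) (hA : 0 < A) :
    ∃ c C : ℝ, 0 ≤ c ∧ 0 ≤ C ∧ ∀ d a b : ℕ, 0 < d → a < d → b < d →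
      Nat.Coprime (a ^ 3 + 2 * b ^ 3) d → ∀ X η Q : ℝ, 4 * ((d : ℝ) + 2) ^ 2 ≤ X → 0 < η → η ≤ 1 →
      1 ≤ Q →
      ∑ R ∈ (idealsLE ⌊2 * Q⌋₊).filter (fun R => Q < (Ideal.absNorm R : ℝ) ∧
          (Ideal.absNorm R : ℝ) ≤ 2 * Q ∧ Squarefree (Ideal.absNorm R)),
        (idealDivisorCount R : ℝ) ^ A *
          |(classCountA X η d a b R : ℝ) -
            (if Nat.Coprime d (Ideal.absNorm R) then
              6 * η ^ 2 * X ^ 2 / Real.pi ^ 2 * zetaTwoCorrection d / (d : ℝ) ^ 2 * rho₂ R /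
                Ideal.absNorm R else 0)| ≤
        C * (Q + X * Real.sqrt Q + X ^ (3 / 2 : ℝ)) * Real.log (Q * X) ^ c := by
  obtain ⟨c₁, C₁, hc₁, hC₁, H51⟩ :=
    class_lemma_5_1_bound_of_lemma_4_7_bound lemma_4_7_bound_holds A hA
  obtain ⟨c₂, C₂, hc₂, hC₂, H47⟩ := lemma_4_7_bound_holds (A + 1) (Nat.succ_pos A)
  obtain ⟨C₃, hC₃, H55⟩ := exists_tail55_le A
  obtain ⟨C₄, hC₄, H4div⟩ := exists_sum_sigma_zero_pow_div_le_real (12 * (A + 1))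
  obtain ⟨C₅, hC₅, H4⟩ := exists_sum_sigma_zero_pow_le_real (12 * (A + 1))
  -- exponents and constants (depending on `A` only)
  obtain ⟨k, hk⟩ : ∃ k : ℕ, k = 2 ^ (12 * (A + 1) + 1) := ⟨_, rfl⟩
  obtain ⟨k₃, hk₃⟩ : ∃ k₃ : ℕ, k₃ = 2 ^ (4 * A + 5) := ⟨_, rfl⟩
  rw [← hk] at H4div H4
  rw [← hk₃] at H55
  set e₁ : ℝ := c₁ + k with he₁
  set e₂ : ℝ := c₂ + k with he₂
  set e₃ : ℝ := (k₃ : ℝ) with he₃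
  set cfin : ℝ := e₁ + e₂ + e₃ with hcfin
  set M : ℝ := (Real.log 2)⁻¹ ^ cfin with hM
  set K₁ : ℝ := C₁ * 2 ^ c₁ * 3 ^ (k : ℝ) * (C₄ + 2 * C₅) with hK₁
  set K₂ : ℝ := C₂ * 5 ^ c₂ * 2 ^ (k : ℝ) * (8 * C₅ + 8 * C₄) with hK₂
  set K₃ : ℝ := 2 * C₃ with hK₃
  have he₁0 : 0 ≤ e₁ := by positivity
  have he₂0 : 0 ≤ e₂ := by positivity
  have he₃0 : 0 ≤ e₃ := by positivity
  have he₁c : e₁ ≤ cfin := by rw [hcfin]; linarith only [he₂0, he₃0]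
  have he₂c : e₂ ≤ cfin := by rw [hcfin]; linarith only [he₁0, he₃0]
  have he₃c : e₃ ≤ cfin := by rw [hcfin]; linarith only [he₁0, he₂0]
  have hK₁0 : 0 ≤ K₁ := by positivity
  have hK₂0 : 0 ≤ K₂ := by positivity
  have hK₃0 : 0 ≤ K₃ := by positivity
  have hM0 : 0 ≤ M := by positivity
  refine ⟨cfin, (K₁ + K₂ + K₃) * M, by positivity, by positivity,
    fun d a b hd _ _ hadm X η Q hXd hη0 hη1 hQ => ?_⟩
  -- the data
  have hd1 : (1 : ℝ) ≤ d := by exact_mod_cast hd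
  have hX : 2 ≤ X := by nlinarith only [hXd, hd1]
  have hX0 : 0 < X := by linarith only [hX]
  have hQ0 : 0 < Q := by linarith only [hQ]
  obtain ⟨hl2L, -, -, -, -, hlsqL, -⟩ := log_bounds hX hQ
  set L : ℝ := Real.log (Q * X) with hL
  have hl2 : 0 < Real.log 2 := Real.log_pos one_lt_two
  have hL0 : 0 < L := hl2.trans_le hl2L
  obtain ⟨hΔ₀1, hΔ₀Δ, hΔ2Δ₀, hΔ₀X, hΔsq, hX2Δ, hQΔ⟩ := delta_bounds hX hQ
  set Δ : ℝ := 1 + min (Real.sqrt X) (X / Real.sqrt Q) with hΔdef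
  set Δ₀ : ℕ := ⌊Δ⌋₊ with hΔ₀def
  have hΔ₀pos : 0 < Δ₀ := hΔ₀1
  have hΔ₀r : (1 : ℝ) ≤ Δ₀ := by exact_mod_cast hΔ₀1
  have hΔpos : 0 < Δ := by linarith only [hΔ₀r, hΔ₀Δ]
  -- the class range: `(d+2)Δ₀ ≤ X`
  have hsX : 2 * ((d : ℝ) + 2) ≤ Real.sqrt X := by
    rw [Real.le_sqrt' (by positivity : (0 : ℝ) < 2 * ((d : ℝ) + 2))]
    nlinarith only [hXd]
  have hs1 : 1 ≤ Real.sqrt X := Real.one_le_sqrt.mpr (by linarith only [hX])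
  have hkey : ((d : ℝ) + 2) * Δ₀ ≤ X :=
    calc ((d : ℝ) + 2) * Δ₀ ≤ ((d : ℝ) + 2) * (1 + Real.sqrt X) :=
          mul_le_mul_of_nonneg_left (hΔ₀Δ.trans hΔsq) (by positivity)
      _ ≤ ((d : ℝ) + 2) * (2 * Real.sqrt X) :=
          mul_le_mul_of_nonneg_left (by linarith only [hs1]) (by positivity)
      _ = 2 * ((d : ℝ) + 2) * Real.sqrt X := by ring
      _ ≤ Real.sqrt X * Real.sqrt X := mul_le_mul_of_nonneg_right hsX (Real.sqrt_nonneg X)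
      _ = X := Real.mul_self_sqrt hX0.le
  have hdΔ₀0 : 0 ≤ (d : ℝ) * Δ₀ := by positivity
  have h2Δ₀X : 2 * (Δ₀ : ℝ) ≤ X := by nlinarith only [hkey, hdΔ₀0]
  have hdΔ₀X : (d : ℝ) * Δ₀ ≤ X := by nlinarith only [hkey, hΔ₀r]
  obtain ⟨D, hDdef⟩ : ∃ D : ℕ, D = ⌊X * (1 + η)⌋₊ := ⟨_, rfl⟩
  obtain ⟨D', hD'def⟩ : ∃ D' : ℕ, D' = max D Δ₀ := ⟨_, rfl⟩
  have hDD' : D ≤ D' := by rw [hD'def]; exact le_max_left _ _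
  have hΔ₀D' : Δ₀ ≤ D' := by rw [hD'def]; exact le_max_right _ _
  have hXη2 : (2 : ℝ) ≤ X * (1 + η) := by nlinarith only [hX, hη0]
  have hD2 : 2 ≤ D := by rw [hDdef]; exact Nat.le_floor (by exact_mod_cast hXη2)
  have hD'2 : 2 ≤ D' := hD2.trans hDD'
  have hDfl : ⌊X * (1 + η)⌋₊ ≤ D' := by rw [← hDdef]; exact hDD'
  have hD'X : (D' : ℝ) ≤ 2 * X := by
    rw [hD'def, Nat.cast_max]
    refine max_le ?_ ?_
    · have h1 : (D : ℝ) ≤ X * (1 + η) := by rw [hDdef]; exact Nat.floor_le (by positivity)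
      have h2 : X * (1 + η) ≤ 2 * X := by nlinarith only [hX0, hη1]
      exact h1.trans h2
    · have hsqrt : Real.sqrt X ≤ X := by
        rw [Real.sqrt_le_left hX0.le]; nlinarith only [hX]
      linarith only [hΔ₀Δ, hΔsq, hsqrt, hX]
  have hx₁ : Real.log (max 2 (Δ₀ : ℝ)) ≤ 3 * L := by
    have h1 : max 2 (Δ₀ : ℝ) ≤ 2 + 2 * Real.sqrt X := by
      refine max_le ?_ ?_
      · linarith only [Real.sqrt_nonneg X]
      · linarith only [hΔ₀Δ, hΔsq, Real.sqrt_nonneg X]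
    exact (Real.log_le_log (by positivity) h1).trans hlsqL
  have hQΔ₀ : Q * Δ₀ ≤ Q + X * Real.sqrt Q := (mul_le_mul_of_nonneg_left hΔ₀Δ hQ0.le).trans hQΔ
  set tr := (idealsLE ⌊2 * Q⌋₊).filter (fun R => Q < (Ideal.absNorm R : ℝ) ∧
    (Ideal.absNorm R : ℝ) ≤ 2 * Q ∧ Squarefree (Ideal.absNorm R)) with htr
  set P : ℝ := Q + X * Real.sqrt Q + X ^ (3 / 2 : ℝ) with hP
  have hP0 : 0 ≤ P := by positivity
  have hQP : X ^ (3 / 2 : ℝ) + X * Real.sqrt Q ≤ P := by rw [hP]; linarith only [hQ0]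
  -- the summands
  set Lf : Ideal (𝓞 K) → ℕ → ℝ := fun R g =>
    (#{xy ∈ latticeBox (X / g) η | g * xy.1 ≡ a [MOD d] ∧ g * xy.2 ≡ b [MOD d] ∧
      R ∣ Ideal.span {(g : 𝓞 K)} * pairIdeal xy} : ℝ) with hLf
  set Mf : Ideal (𝓞 K) → ℕ → ℝ := fun R g =>
    if Nat.Coprime g d ∧ Nat.Coprime d (Ideal.absNorm R) then
      η ^ 2 * X ^ 2 * Ideal.absNorm (R ⊔ Ideal.span {(g : 𝓞 K)}) /
        ((g : ℝ) ^ 2 * (d : ℝ) ^ 2 * Ideal.absNorm R) else 0 with hMf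
  set Uf : Ideal (𝓞 K) → ℝ := fun R =>
    η ^ 2 * X ^ 2 / ((d : ℝ) ^ 2 * Ideal.absNorm R) * (4 * σ 0 (Ideal.absNorm R) / Δ₀) with hUf
  -- Step 1: the split, pointwise in `R`
  have hstep1 : ∀ R ∈ tr, (idealDivisorCount R : ℝ) ^ A *
      |(classCountA X η d a b R : ℝ) -
        (if Nat.Coprime d (Ideal.absNorm R) then
          6 * η ^ 2 * X ^ 2 / Real.pi ^ 2 * zetaTwoCorrection d / (d : ℝ) ^ 2 * rho₂ R /
            Ideal.absNorm R else 0)| ≤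
      (idealDivisorCount R : ℝ) ^ A *
        (∑ g ∈ Icc 1 Δ₀, |Lf R g - Mf R g| + ∑ g ∈ Ioc Δ₀ D', Lf R g + Uf R) := by
    intro R hR
    rw [htr, mem_filter] at hR
    obtain ⟨-, -, -, hsq⟩ := hR
    exact mul_le_mul_of_nonneg_left
      (abs_classCountA_sub_mainTerm_le hX0.le hsq hd hadm hΔ₀pos hΔ₀D' hDfl) (by positivity)
  -- Step 2: summation over `R` and interchange
  have hstep2 : ∑ R ∈ tr, (idealDivisorCount R : ℝ) ^ A *
        (∑ g ∈ Icc 1 Δ₀, |Lf R g - Mf R g| + ∑ g ∈ Ioc Δ₀ D', Lf R g + Uf R) =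
      ∑ g ∈ Icc 1 Δ₀, ∑ R ∈ tr, (idealDivisorCount R : ℝ) ^ A * |Lf R g - Mf R g| +
        ∑ g ∈ Ioc Δ₀ D', ∑ R ∈ tr, (idealDivisorCount R : ℝ) ^ A * Lf R g +
          ∑ R ∈ tr, (idealDivisorCount R : ℝ) ^ A * Uf R := by
    simp only [mul_add, sum_add_distrib, mul_sum]
    congr 1
    congr 1
    · exact sum_comm
    · exact sum_comm
  -- Step 3: the three pieces
  have hhead : ∑ g ∈ Icc 1 Δ₀, ∑ R ∈ tr, (idealDivisorCount R : ℝ) ^ A * |Lf R g - Mf R g| ≤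
      K₁ * P * L ^ e₁ :=
    class_head_total_le hc₁ hC₁ hC₄.le hC₅.le
      (fun a' b' ha' hb' hadm' => H51 d a' b' hd ha' hb' hadm') H4div H4 hd hadm hX hη0 hη1 hQ
      hΔ₀pos h2Δ₀X hdΔ₀X hx₁ hQΔ₀
  have htail56 : ∑ g ∈ Ioc Δ₀ D', ∑ R ∈ tr, (idealDivisorCount R : ℝ) ^ A * Lf R g ≤
      K₂ * P * L ^ e₂ := by
    refine le_trans ?_ (tail56_total_le hc₂ hC₂ hC₄.le hC₅.le H47 H4div H4 tr hX hη0.le hη1 hQ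
      hΔ₀pos hD'2 hD'X hΔpos hΔ2Δ₀ hX2Δ)
    refine sum_le_sum fun g _ => sum_le_sum fun R _ => mul_le_mul_of_nonneg_left ?_ (by positivity)
    simp only [hLf]
    exact_mod_cast class_moebiusTerm_le (X / g) η g d a b R
  have htail55 : ∑ R ∈ tr, (idealDivisorCount R : ℝ) ^ A * Uf R ≤ K₃ * P * L ^ e₃ := by
    obtain ⟨-, -, hl2QL, -, -, -, -⟩ := log_bounds hX hQ
    have h1d : (1 : ℝ) ≤ (d : ℝ) ^ 2 := one_le_pow₀ hd1
    have hUU : ∀ R ∈ tr, (idealDivisorCount R : ℝ) ^ A * Uf R ≤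
        (idealDivisorCount R : ℝ) ^ A *
          (η ^ 2 * X ^ 2 / Ideal.absNorm R * (4 * σ 0 (Ideal.absNorm R) / Δ₀)) := by
      intro R _
      refine mul_le_mul_of_nonneg_left ?_ (by positivity)
      simp only [hUf]
      rw [mul_comm ((d : ℝ) ^ 2) _, ← div_div]
      exact mul_le_mul_of_nonneg_right (div_le_self (by positivity) h1d) (by positivity)
    have h := H55 X η Q hη0.le hη1 hQ Δ₀ hΔ₀pos
    have hlog2Q0 : 0 ≤ Real.log (2 * Q) := Real.log_nonneg (by linarith only [hQ])
    have hlog : Real.log (2 * Q) ^ k₃ ≤ L ^ k₃ := pow_le_pow_left₀ hlog2Q0 hl2QL k₃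
    have hinvΔ : (Δ₀ : ℝ)⁻¹ ≤ 2 / Δ := by
      rw [inv_eq_one_div, div_le_div_iff₀ (by linarith only [hΔ₀r]) hΔpos]
      linarith only [hΔ2Δ₀]
    calc ∑ R ∈ tr, (idealDivisorCount R : ℝ) ^ A * Uf R
        ≤ ∑ R ∈ tr, (idealDivisorCount R : ℝ) ^ A *
            (η ^ 2 * X ^ 2 / Ideal.absNorm R * (4 * σ 0 (Ideal.absNorm R) / Δ₀)) := sum_le_sum hUU
      _ ≤ C₃ * X ^ 2 * Real.log (2 * Q) ^ k₃ / Δ₀ := h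
      _ = C₃ * Real.log (2 * Q) ^ k₃ * X ^ 2 * (Δ₀ : ℝ)⁻¹ := by ring
      _ ≤ C₃ * L ^ k₃ * X ^ 2 * (2 / Δ) := by gcongr
      _ = 2 * C₃ * (X ^ 2 / Δ) * L ^ k₃ := by ring
      _ ≤ 2 * C₃ * P * L ^ k₃ := by
          refine mul_le_mul_of_nonneg_right
            (mul_le_mul_of_nonneg_left (hX2Δ.trans hQP) (by positivity)) ?_
          positivity
      _ = K₃ * P * L ^ e₃ := by rw [hK₃, he₃, Real.rpow_natCast]
  -- Step 4: the exponents
  have hpow : ∀ {e : ℝ}, 0 ≤ e → e ≤ cfin → L ^ e ≤ M * L ^ cfin := fun he hec =>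
    rpow_le_inv_log_two_pow_mul hl2L he hec
  calc ∑ R ∈ tr, (idealDivisorCount R : ℝ) ^ A *
          |(classCountA X η d a b R : ℝ) -
            (if Nat.Coprime d (Ideal.absNorm R) then
              6 * η ^ 2 * X ^ 2 / Real.pi ^ 2 * zetaTwoCorrection d / (d : ℝ) ^ 2 * rho₂ R /
                Ideal.absNorm R else 0)|
      ≤ ∑ R ∈ tr, (idealDivisorCount R : ℝ) ^ A *
          (∑ g ∈ Icc 1 Δ₀, |Lf R g - Mf R g| + ∑ g ∈ Ioc Δ₀ D', Lf R g + Uf R) :=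
        sum_le_sum hstep1
    _ = _ := hstep2
    _ ≤ K₁ * P * L ^ e₁ + K₂ * P * L ^ e₂ + K₃ * P * L ^ e₃ :=
        add_le_add (add_le_add hhead htail56) htail55
    _ ≤ K₁ * P * (M * L ^ cfin) + K₂ * P * (M * L ^ cfin) + K₃ * P * (M * L ^ cfin) := by
        refine add_le_add (add_le_add ?_ ?_) ?_
        · exact mul_le_mul_of_nonneg_left (hpow he₁0 he₁c) (by positivity)
        · exact mul_le_mul_of_nonneg_left (hpow he₂0 he₂c) (by positivity)
        · exact mul_le_mul_of_nonneg_left (hpow he₃0 he₃c) (by positivity)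
    _ = (K₁ + K₂ + K₃) * M * (Q + X * Real.sqrt Q + X ^ (3 / 2 : ℝ)) *
          Real.log (Q * X) ^ cfin := by
        rw [hP, hL]; ring

end Literature.NumberTheory.Sieve.CubicSieve

end
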